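import Summits.PneNP.PneNP.Theorems.ExpanderLinearGeneratorsCountingFrameBarrierSos
import Summits.PneNP.PneNP.Theorems.ExpanderLinearGeneratorsCountingFrameBarrierEncoding

/-!
# PneNP / ExpanderLinearGenerators — the COUNTING-FRAME BARRIER (Barrier III) for
`ExpansionForcesDepthFregeSize` (helper file for stmt-PneNP-11442, `--supports`)

Route `PneNP/ExpanderLinearGenerators`, crux stmt-PneNP-11442
(`Summit.PneNP.PneNP.Theses.ExpanderLinearGenerators.ExpansionForcesDepthFregeSize`: depth-`d`
Frege refutations of the XOR-CNF `sumEncoding 1 E` of an unsolvable `ℓ`-sparse system over `𝔽₂`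
with `(r, 3ℓ/4)`-boundary-expanding supports have size `≥ 2^{r^ε}`). The route's own
`why_might_fail` for the crux reads: "with `m ≫ n`, WPHP-style quasi-poly counting (`WPHP^{n²}_n`
easy in `F_d`) may certify `Im A` small; a structured column-weight-`> 2` expander may carry a
depth-`O(1)`-summable certificate". A falsifier of that kind instantiates a PIGEONHOLE FRAME inside
the system: "hole predicates" `P i h` (pigeon `i < N` sits in hole `h < K`, `K < N`) of degree
`≤ t`, with Booleanity, hole clash and totality DERIVED from the rows — in the algebraic proof
systems that measure such derivations, validated by every degree-`d` pseudoexpectation of the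
XOR-CNF. This file kernel-checks that no boundary expander carries such a frame beyond the scale
`r < 2d/c`:

* `apply_eq_zero_of_satisfiesIdentity` — an identity valid in degree `d` has pseudoexpectation `0`.
* `lt_of_phpFrame_validated` — **Theorem III.** If the row supports of `E` form an
  `(r, c)`-boundary expander (`c > 0`, `r ≥ 2`) and polynomials `P i h` of degree `≤ t`, `2t ≤ d`,
  `K < N`, are such that EVERY degree-`d` pseudoexpectation satisfying Booleanity and the clause
  identities of `sumEncoding 1 E` validates the frame (`Ẽ[P²] = Ẽ[P]`, `Ẽ[P i h · P j h] = 0` for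
  `i ≠ j`, `Ẽ[Σ_h P i h] ≥ 1`), then `c · r < 2 d`.
  Proof: the Grigoriev–Schoenebeck pseudoexpectation of the expander
  (`sosFailsToRefute_sumEncoding_of_isBoundaryExpander`, degree `⌊c r/2⌋ ≥ d`) would validate the
  frame, contradicting the Grigoriev–Hirsch–Pasechnik refutation
  (`not_phpFrame_of_isPseudoexpectation`).
* `lt_of_phpFrame_identities` — the same with the frame given by IDENTITIES
  (`SatisfiesIdentity d Ẽ (P² - P)`, `… (P i h · P j h)`, `… (Σ_h P i h - 1)`), the form produced
  by Nullstellensatz / Positivstellensatz derivations of degree `≤ d` from the clauses.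
* `lt_of_phpFrame_validated_route` — the route's normalisation `c = 3ℓ/4`: `3ℓ·r < 8d`.

Reading (memo `memo-11442-s21-counting-frame-barrier.md` on the item): approximate counting is
SOS-cheap uniformly in `N, K` while expanding XOR systems are SOS-hard up to degree `c r/2`, so a
pigeonhole / WPHP certificate can live inside an `(r, 3ℓ/4)`-expander only at scale
`r = O(d/ℓ)` — with pattern predicates of width `t = log₂ K` derived from `O(1)` rows each this is
`r = O(log K / ℓ)`, i.e. proof size `≥ K ≥ 2^{Ω(ℓ r)}`, consistent with the crux; the only escape
is a frame axiom whose cheapest derivation has SOS degree `Ω(ℓ r)` (derivations at the expansion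
scale — the open core of the item).

References: D. Grigoriev, TCS 259 (2001); G. Schoenebeck, FOCS 2008; M. Tulsiani, STOC 2009;
D. Grigoriev, E. A. Hirsch, D. V. Pasechnik, Moscow Math. J. 2 (2002), §4;
P. Kothari, R. Mori, R. O'Donnell, D. Witmer, STOC 2017 [arXiv170104521];
J. Krajíček, *Proof Complexity* (CUP 2019), §13.4, Problem 19.4.5 [KrajicekProofComplexity2019].
-/

noncomputable section

namespace Summit.PneNP.PneNP.Theorems

set_option linter.dupNamespace false -- `Summit.PneNP.PneNP.…`: summit = sub-problem (D-0017)

open Finset MvPolynomial Literature.Computability.Complexity Literature.Computability.MetaComplexity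

namespace CountingFrameBarrier

variable {m n : ℕ}

/-- An identity `q = 0` satisfied in degree `d` by `Ẽ` has `Ẽ[q] = 0` as soon as `deg q ≤ d`
(take the cofactor `1`). [Kothari–Mori–O'Donnell–Witmer 2017, Def. 2.8] [folklore] -/
theorem apply_eq_zero_of_satisfiesIdentity {d : ℕ} {Ex : MvPolynomial ℕ ℝ →ₗ[ℝ] ℝ}
    {q : MvPolynomial ℕ ℝ} (h : SatisfiesIdentity d Ex q) (hq : q.totalDegree ≤ d) :
    Ex q = 0 := by
  have h1 := h 1 (by rw [totalDegree_one, add_zero]; exact hq)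
  rwa [mul_one] at h1

/-- **Theorem III (counting-frame barrier).** Let the row supports of `E` form an
`(r, c)`-boundary expander (`c > 0`, `r ≥ 2`), and let `P i h` (`i < N`, `h < K`, `K < N`) be
polynomials of degree `≤ t`, `2t ≤ d`, such that every degree-`d` pseudoexpectation satisfying
Booleanity and the clause identities of `sumEncoding 1 E` validates the pigeonhole frame on the
`P`'s (Booleanity `Ẽ[P²] = Ẽ[P]`, clash `Ẽ[P i h · P j h] = 0` for `i ≠ j`, totality
`1 ≤ Ẽ[Σ_h P i h]`). Then `c · r < 2d`: a pigeonhole / WPHP certificate of SOS-degree `d` fits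
inside a boundary expander only at scale `r < 2d/c`.
[Grigoriev 2001; Schoenebeck 2008, Thm. 4.1; Grigoriev–Hirsch–Pasechnik 2002, §4; this
combination: the item's memo, Thm. III] [folklore] -/
theorem lt_of_phpFrame_validated {N K t d : ℕ} (E : Fin m → LinEqMod 2 n) {r c : ℝ}
    (hexp : IsBoundaryExpander (fun i => (E i).supp.map Fin.valEmbedding) r c)
    (hc : 0 < c) (hr : 2 ≤ r) (hNK : K < N)
    (P : Fin N → Fin K → MvPolynomial ℕ ℝ) (hdeg : ∀ i h, (P i h).totalDegree ≤ t)
    (h2t : 2 * t ≤ d)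
    (hframe : ∀ Ex : MvPolynomial ℕ ℝ →ₗ[ℝ] ℝ, IsPseudoexpectation d Ex →
      (∀ v, SatisfiesIdentity d Ex (boolAxiom v)) →
      (∀ C ∈ sumEncoding 1 E, SatisfiesIdentity d Ex (unsatPoly C)) →
      (∀ i h, Ex (P i h * P i h) = Ex (P i h)) ∧
      (∀ h i j, i ≠ j → Ex (P i h * P j h) = 0) ∧
      (∀ i, 1 ≤ Ex (∑ h, P i h))) :
    c * r < 2 * d := by
  by_contra hle
  push Not at hle
  have hd : (d : ℝ) ≤ c * r / 2 := by linarith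
  obtain ⟨Ex, hE, hbool, hcl⟩ := sosFailsToRefute_sumEncoding_of_isBoundaryExpander E hexp hc hr hd
  obtain ⟨hb, hclash, htot⟩ := hframe Ex hE hbool hcl
  exact not_phpFrame_of_isPseudoexpectation Ex hE P hdeg h2t hb hclash htot hNK

/-- **Theorem III, identity form.** The same conclusion `c · r < 2d` when the frame is given by
IDENTITIES valid for every degree-`d` pseudoexpectation of the XOR-CNF — Booleanity
`P i h · P i h - P i h = 0`, clash `P i h · P j h = 0` (`i ≠ j`) and the partition form of
totality `Σ_h P i h - 1 = 0` — which is what a Nullstellensatz / Positivstellensatz derivation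
of degree `≤ d` of these axioms from the clauses of `sumEncoding 1 E` provides.
[Grigoriev–Hirsch–Pasechnik 2002, §4; the item's memo, Thm. III / Cor. A] [folklore] -/
theorem lt_of_phpFrame_identities {N K t d : ℕ} (E : Fin m → LinEqMod 2 n) {r c : ℝ}
    (hexp : IsBoundaryExpander (fun i => (E i).supp.map Fin.valEmbedding) r c)
    (hc : 0 < c) (hr : 2 ≤ r) (hNK : K < N)
    (P : Fin N → Fin K → MvPolynomial ℕ ℝ) (hdeg : ∀ i h, (P i h).totalDegree ≤ t)
    (h2t : 2 * t ≤ d)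
    (hframe : ∀ Ex : MvPolynomial ℕ ℝ →ₗ[ℝ] ℝ, IsPseudoexpectation d Ex →
      (∀ v, SatisfiesIdentity d Ex (boolAxiom v)) →
      (∀ C ∈ sumEncoding 1 E, SatisfiesIdentity d Ex (unsatPoly C)) →
      (∀ i h, SatisfiesIdentity d Ex (P i h * P i h - P i h)) ∧
      (∀ h i j, i ≠ j → SatisfiesIdentity d Ex (P i h * P j h)) ∧
      (∀ i, SatisfiesIdentity d Ex (∑ h, P i h - 1))) :
    c * r < 2 * d := by
  classical
  refine lt_of_phpFrame_validated E hexp hc hr hNK P hdeg h2t fun Ex hE hbool hcl => ?_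
  obtain ⟨hb, hclash, htot⟩ := hframe Ex hE hbool hcl
  have hmul : ∀ i j h h', (P i h * P j h').totalDegree ≤ d := fun i j h h' =>
    (totalDegree_mul _ _).trans (by have := hdeg i h; have := hdeg j h'; omega)
  refine ⟨fun i h => ?_, fun h i j hij => ?_, fun i => ?_⟩
  · have h1 : Ex (P i h * P i h - P i h) = 0 := by
      refine apply_eq_zero_of_satisfiesIdentity (hb i h) ((totalDegree_sub _ _).trans ?_)
      exact max_le (hmul i i h h) ((hdeg i h).trans (by omega))
    rw [map_sub] at h1
    linarith
  · exact apply_eq_zero_of_satisfiesIdentity (hclash h i j hij) (hmul i j h h)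
  · have h1 : Ex (∑ h, P i h - 1) = 0 := by
      refine apply_eq_zero_of_satisfiesIdentity (htot i) ((totalDegree_sub _ _).trans ?_)
      rw [totalDegree_one]
      exact max_le ((totalDegree_finsetSum_le fun h _ => hdeg i h).trans (by omega))
        (Nat.zero_le _)
    rw [map_sub, hE.1] at h1
    linarith

/-- **The route's normalisation** (`c = 3/4·ℓ`, as in `ExpansionForcesDepthFregeSize`): a
pigeonhole / WPHP frame of SOS-degree `d` inside the XOR-CNF of an `ℓ`-sparse
`(r, 3ℓ/4)`-boundary expander forces `3ℓ·r < 8d`, i.e. `r < 8d/(3ℓ)` — logarithmic in the number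
of holes for pattern predicates of width `log₂ K` derived from `O(1)` rows, so such a refutation
has size `≥ K ≥ 2^{Ω(ℓ r)}`, as the crux asserts. [the item's memo, Thm. III] [folklore] -/
theorem lt_of_phpFrame_validated_route {N K t d : ℕ} (ℓ : ℕ) (E : Fin m → LinEqMod 2 n)
    {r : ℝ} (hℓ : 1 ≤ ℓ)
    (hexp : IsBoundaryExpander (fun i => (E i).supp.map Fin.valEmbedding) r (3 / 4 * ℓ))
    (hr : 2 ≤ r) (hNK : K < N)
    (P : Fin N → Fin K → MvPolynomial ℕ ℝ) (hdeg : ∀ i h, (P i h).totalDegree ≤ t)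
    (h2t : 2 * t ≤ d)
    (hframe : ∀ Ex : MvPolynomial ℕ ℝ →ₗ[ℝ] ℝ, IsPseudoexpectation d Ex →
      (∀ v, SatisfiesIdentity d Ex (boolAxiom v)) →
      (∀ C ∈ sumEncoding 1 E, SatisfiesIdentity d Ex (unsatPoly C)) →
      (∀ i h, Ex (P i h * P i h) = Ex (P i h)) ∧
      (∀ h i j, i ≠ j → Ex (P i h * P j h) = 0) ∧
      (∀ i, 1 ≤ Ex (∑ h, P i h))) :
    3 * ℓ * r < 8 * d := by
  have hℓ' : (1 : ℝ) ≤ ℓ := by exact_mod_cast hℓ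
  have hc : (0 : ℝ) < 3 / 4 * ℓ := by linarith
  have h := lt_of_phpFrame_validated E hexp hc hr hNK P hdeg h2t hframe
  linarith

end CountingFrameBarrier

end Summit.PneNP.PneNP.Theorems
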